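import Mathlib
import Literature.Analysis.FluidPDE.SelfSimilarEulerProfile
import Summits.NavierStokesRegularity.NavierStokesRegularity.Theorems.EulerZoomLiouvillePowerGaugeEulerLiouvilleHoopFrame

/-!
# Hoop core — AX-1: the radial frame as a FIELD and the ê_r-component of the profile equation

Sub-problem `NavierStokesRegularity`, crux `PowerGaugeEulerLiouville` (a crux CLASS of self-similar Euler/NS strata — not NS
regularity).  K-AXIS split, plate AX-1 (LEAD 19832, 2026-08-29): off the `x₂`-axis,
* the frame fields are differentiable with `D ê_r(y)[w] = (⟪w, ê_θ⟫/r) ê_θ`, `D ê_θ(y)[w] = −(⟪w, ê_θ⟫/r) ê_r` (`r = cylRadius y`);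
* hence the kinematic identities `⟪DV(y) w, ê_r⟫ = D(V_r)(y)[w] − V_θ ⟪w, ê_θ⟫/r` and `⟪DV(y) w, ê_θ⟫ = D(V_θ)(y)[w] + V_r ⟪w, ê_θ⟫/r`;
* for a self-similar Euler profile pair `IsSelfSimilarEulerProfile γ 0 V P` with transport field `W = γy + V`, the ê_r-component
  of the profile equation reads `(1−γ)V_r + D(V_r)[W] − V_θ²/r + ⟪∇P, ê_r⟫ = 0` (`⟪W, ê_θ⟫ = V_θ` since `⟪y, ê_θ(y)⟫ = 0`): the
  pointwise input of the axis law (AX) of HOOP-NOTE §2.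
-/

noncomputable section

set_option linter.dupNamespace false

open Set Function WithLp Metric
open scoped InnerProductSpace RealInnerProductSpace

namespace Summit.NavierStokesRegularity.NavierStokesRegularity.Theorems.PowerGaugeEulerLiouville.HoopCore

open Literature.Analysis Literature.Analysis.FluidPDE

/-! ### Coordinates, the horizontal part, the frame in coordinates -/

/-- Coordinates of the real inner product on `ℝ³` (local copy). [folklore] -/
private theorem inner_three (x y : EuclideanSpace ℝ (Fin 3)) : ⟪x, y⟫ = x 0 * y 0 + x 1 * y 1 + x 2 * y 2 := by
  simp only [PiLp.inner_apply, Fin.sum_univ_three, RCLike.inner_apply, conj_trivial]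
  ring

/-- The coordinate function `y ↦ y i` has derivative `EuclideanSpace.proj i`. [folklore] -/
theorem hasFDerivAt_coord (i : Fin 3) (y : EuclideanSpace ℝ (Fin 3)) :
    HasFDerivAt (fun y : EuclideanSpace ℝ (Fin 3) => y i)
      (EuclideanSpace.proj i : EuclideanSpace ℝ (Fin 3) →L[ℝ] ℝ) y :=
  (EuclideanSpace.proj (𝕜 := ℝ) i : EuclideanSpace ℝ (Fin 3) →L[ℝ] ℝ).hasFDerivAt

/-- `r` is positive off the axis. [folklore] -/
theorem cylRadius_pos_of_ne {y : EuclideanSpace ℝ (Fin 3)} (hy : cylRadius y ≠ 0) : 0 < cylRadius y :=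
  lt_of_le_of_ne (cylRadius_nonneg y) (Ne.symm hy)

/-- `⟪w, ê_r(y)⟫ = (w₀y₀ + w₁y₁)/r`. [folklore] -/
theorem inner_eR_eq (w y : EuclideanSpace ℝ (Fin 3)) :
    ⟪w, eR y⟫ = (w 0 * y 0 + w 1 * y 1) / cylRadius y := by
  rw [eR, inner_smul_right, inner_three]
  simp
  ring

/-- `⟪w, ê_θ(y)⟫ = (−w₀y₁ + w₁y₀)/r`. [folklore] -/
theorem inner_eTheta_eq (w y : EuclideanSpace ℝ (Fin 3)) :
    ⟪w, eTheta y⟫ = (-(w 0 * y 1) + w 1 * y 0) / cylRadius y := by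
  rw [eTheta, inner_smul_right, inner_three]
  simp
  ring

/-- The position vector has no angular component: `⟪y, ê_θ(y)⟫ = 0`. [folklore] -/
theorem inner_self_eTheta (y : EuclideanSpace ℝ (Fin 3)) : ⟪y, eTheta y⟫ = 0 := by
  rw [inner_eTheta_eq]; ring

/-- The horizontal part of `y` is `r ê_r(y)` (off the axis). [folklore] -/
theorem horizontal_self {y : EuclideanSpace ℝ (Fin 3)} (hy : cylRadius y ≠ 0) :
    toLp 2 ![y 0, y 1, 0] = cylRadius y • eR y := by
  rw [eR, smul_smul, mul_inv_cancel₀ hy, one_smul]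

/-- The rotated horizontal part of `y` is `r ê_θ(y)` (off the axis). [folklore] -/
theorem horizontalRot_self {y : EuclideanSpace ℝ (Fin 3)} (hy : cylRadius y ≠ 0) :
    toLp 2 ![-y 1, y 0, 0] = cylRadius y • eTheta y := by
  rw [eTheta, smul_smul, mul_inv_cancel₀ hy, one_smul]

/-- Frame decomposition of the horizontal part of any vector (off the axis):
`(w₀, w₁, 0) = ⟪w, ê_r⟫ ê_r + ⟪w, ê_θ⟫ ê_θ`. [folklore] -/
theorem horizontal_eq_frame {y : EuclideanSpace ℝ (Fin 3)} (hy : cylRadius y ≠ 0) (w : EuclideanSpace ℝ (Fin 3)) :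
    toLp 2 ![w 0, w 1, 0] = ⟪w, eR y⟫ • eR y + ⟪w, eTheta y⟫ • eTheta y := by
  have hr2 : cylRadius y ^ 2 = y 0 ^ 2 + y 1 ^ 2 := cylRadius_sq y
  rw [inner_eR_eq, inner_eTheta_eq]
  ext i
  fin_cases i
  · simp [eR, eTheta]; field_simp; linear_combination (w 0) * hr2
  · simp [eR, eTheta]; field_simp; linear_combination (w 1) * hr2
  · simp [eR, eTheta]

/-- Frame decomposition of the rotated horizontal part: `(−w₁, w₀, 0) = −⟪w, ê_θ⟫ ê_r + ⟪w, ê_r⟫ ê_θ`. [folklore] -/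
theorem horizontalRot_eq_frame {y : EuclideanSpace ℝ (Fin 3)} (hy : cylRadius y ≠ 0) (w : EuclideanSpace ℝ (Fin 3)) :
    toLp 2 ![-w 1, w 0, 0] = -(⟪w, eTheta y⟫ • eR y) + ⟪w, eR y⟫ • eTheta y := by
  have hr2 : cylRadius y ^ 2 = y 0 ^ 2 + y 1 ^ 2 := cylRadius_sq y
  rw [inner_eR_eq, inner_eTheta_eq]
  ext i
  fin_cases i
  · simp [eR, eTheta]; field_simp; linear_combination (-(w 1)) * hr2
  · simp [eR, eTheta]; field_simp; linear_combination (w 0) * hr2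
  · simp [eR, eTheta]

/-! ### The derivative of the cylindrical radius and of the frame fields -/

/-- `D r(y) = (2r)⁻¹ • D(y₀² + y₁²)` off the axis. [folklore] -/
theorem hasFDerivAt_cylRadius {y : EuclideanSpace ℝ (Fin 3)} (hy : cylRadius y ≠ 0) :
    HasFDerivAt cylRadius ((1 / (2 * cylRadius y)) •
      ((y 0 • (EuclideanSpace.proj (0 : Fin 3) : EuclideanSpace ℝ (Fin 3) →L[ℝ] ℝ) +
          y 0 • (EuclideanSpace.proj (0 : Fin 3) : EuclideanSpace ℝ (Fin 3) →L[ℝ] ℝ)) +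
        (y 1 • (EuclideanSpace.proj (1 : Fin 3) : EuclideanSpace ℝ (Fin 3) →L[ℝ] ℝ) +
          y 1 • (EuclideanSpace.proj (1 : Fin 3) : EuclideanSpace ℝ (Fin 3) →L[ℝ] ℝ)))) y := by
  have hq : y 0 ^ 2 + y 1 ^ 2 ≠ 0 := by rw [← cylRadius_sq]; exact pow_ne_zero 2 hy
  have h0 := hasFDerivAt_coord 0 y
  have h1 := hasFDerivAt_coord 1 y
  have hsq : HasFDerivAt (fun y : EuclideanSpace ℝ (Fin 3) => y 0 ^ 2 + y 1 ^ 2)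
      ((y 0 • (EuclideanSpace.proj (0 : Fin 3) : EuclideanSpace ℝ (Fin 3) →L[ℝ] ℝ) +
          y 0 • (EuclideanSpace.proj (0 : Fin 3) : EuclideanSpace ℝ (Fin 3) →L[ℝ] ℝ)) +
        (y 1 • (EuclideanSpace.proj (1 : Fin 3) : EuclideanSpace ℝ (Fin 3) →L[ℝ] ℝ) +
          y 1 • (EuclideanSpace.proj (1 : Fin 3) : EuclideanSpace ℝ (Fin 3) →L[ℝ] ℝ))) y := by
    have e : (fun y : EuclideanSpace ℝ (Fin 3) => y 0 ^ 2 + y 1 ^ 2) =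
        fun y : EuclideanSpace ℝ (Fin 3) => y 0 * y 0 + y 1 * y 1 := by
      funext y; ring
    rw [e]
    exact (h0.mul h0).add (h1.mul h1)
  exact hsq.sqrt hq

/-- `D r(y)[w] = ⟪w, ê_r(y)⟫` (applied form). [folklore] -/
theorem fderiv_cylRadius_apply {y : EuclideanSpace ℝ (Fin 3)} (hy : cylRadius y ≠ 0) (w : EuclideanSpace ℝ (Fin 3)) :
    fderiv ℝ cylRadius y w = ⟪w, eR y⟫ := by
  rw [(hasFDerivAt_cylRadius hy).fderiv, inner_eR_eq]
  simp only [smul_apply, add_apply, smul_eq_mul]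
  have : ∀ i : Fin 3, (EuclideanSpace.proj i : EuclideanSpace ℝ (Fin 3) →L[ℝ] ℝ) w = w i := fun i => rfl
  rw [this, this]
  have hr : cylRadius y ≠ 0 := hy
  unfold cylRadius at hr ⊢
  field_simp
  ring

/-- **THE RADIAL FRAME FIELD IS DIFFERENTIABLE OFF THE AXIS.** [folklore] -/
theorem differentiableAt_eR {y : EuclideanSpace ℝ (Fin 3)} (hy : cylRadius y ≠ 0) : DifferentiableAt ℝ eR y := by
  have h1 : DifferentiableAt ℝ (fun y => (cylRadius y)⁻¹) y :=
    (hasFDerivAt_cylRadius hy).differentiableAt.inv hy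
  have h2 : DifferentiableAt ℝ (fun y : EuclideanSpace ℝ (Fin 3) => toLp 2 ![y 0, y 1, 0]) y := by
    have e : (fun y : EuclideanSpace ℝ (Fin 3) => toLp 2 ![y 0, y 1, 0]) =
        ((EuclideanSpace.proj (0 : Fin 3) : EuclideanSpace ℝ (Fin 3) →L[ℝ] ℝ).smulRight
            (EuclideanSpace.single (0 : Fin 3) (1 : ℝ)) +
          (EuclideanSpace.proj (1 : Fin 3) : EuclideanSpace ℝ (Fin 3) →L[ℝ] ℝ).smulRight
            (EuclideanSpace.single (1 : Fin 3) (1 : ℝ)) :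
              EuclideanSpace ℝ (Fin 3) →L[ℝ] EuclideanSpace ℝ (Fin 3)) := by
      funext y; ext i; fin_cases i <;> simp
    rw [e]; exact ContinuousLinearMap.differentiableAt _
  exact h1.smul h2

/-- **`D ê_r(y)[w] = (⟪w, ê_θ⟫/r) ê_θ`** off the axis. [folklore] -/
theorem fderiv_eR_apply {y : EuclideanSpace ℝ (Fin 3)} (hy : cylRadius y ≠ 0) (w : EuclideanSpace ℝ (Fin 3)) :
    fderiv ℝ eR y w = (⟪w, eTheta y⟫ / cylRadius y) • eTheta y := by
  set Hh : EuclideanSpace ℝ (Fin 3) →L[ℝ] EuclideanSpace ℝ (Fin 3) :=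
    (EuclideanSpace.proj (0 : Fin 3) : EuclideanSpace ℝ (Fin 3) →L[ℝ] ℝ).smulRight
        (EuclideanSpace.single (0 : Fin 3) (1 : ℝ)) +
      (EuclideanSpace.proj (1 : Fin 3) : EuclideanSpace ℝ (Fin 3) →L[ℝ] ℝ).smulRight
        (EuclideanSpace.single (1 : Fin 3) (1 : ℝ)) with hHh
  have hHw : ∀ v : EuclideanSpace ℝ (Fin 3), Hh v = toLp 2 ![v 0, v 1, 0] := by
    intro v; rw [hHh]; ext i; fin_cases i <;> simp
  have hc := (hasFDerivAt_cylRadius hy).differentiableAt.hasFDerivAt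
  have h1 : HasFDerivAt (fun y => (cylRadius y)⁻¹) ((-(cylRadius y ^ 2)⁻¹) • fderiv ℝ cylRadius y) y :=
    (hasDerivAt_inv hy).comp_hasFDerivAt y hc
  have h2 : HasFDerivAt (fun y : EuclideanSpace ℝ (Fin 3) => toLp 2 ![y 0, y 1, 0]) Hh y := by
    have e : (fun y : EuclideanSpace ℝ (Fin 3) => toLp 2 ![y 0, y 1, 0]) = Hh := by
      funext v; exact (hHw v).symm
    rw [e]; exact Hh.hasFDerivAt
  have h : HasFDerivAt eR _ y := h1.smul h2
  rw [h.fderiv]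
  simp only [add_apply, smul_apply,
    ContinuousLinearMap.smulRight_apply, smul_eq_mul, fderiv_cylRadius_apply hy, hHw, horizontal_eq_frame hy w,
    horizontal_self hy, smul_add, smul_smul]
  have e1 : -(cylRadius y ^ 2)⁻¹ * ⟪w, eR y⟫ * cylRadius y = -((cylRadius y)⁻¹ * ⟪w, eR y⟫) := by
    field_simp
  rw [e1, div_eq_inv_mul]
  module

/-- **THE ANGULAR FRAME FIELD IS DIFFERENTIABLE OFF THE AXIS.** [folklore] -/
theorem differentiableAt_eTheta {y : EuclideanSpace ℝ (Fin 3)} (hy : cylRadius y ≠ 0) :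
    DifferentiableAt ℝ eTheta y := by
  have h1 : DifferentiableAt ℝ (fun y => (cylRadius y)⁻¹) y :=
    (hasFDerivAt_cylRadius hy).differentiableAt.inv hy
  have h2 : DifferentiableAt ℝ (fun y : EuclideanSpace ℝ (Fin 3) => toLp 2 ![-y 1, y 0, 0]) y := by
    have e : (fun y : EuclideanSpace ℝ (Fin 3) => toLp 2 ![-y 1, y 0, 0]) =
        ((-(EuclideanSpace.proj (1 : Fin 3) : EuclideanSpace ℝ (Fin 3) →L[ℝ] ℝ)).smulRight
            (EuclideanSpace.single (0 : Fin 3) (1 : ℝ)) +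
          (EuclideanSpace.proj (0 : Fin 3) : EuclideanSpace ℝ (Fin 3) →L[ℝ] ℝ).smulRight
            (EuclideanSpace.single (1 : Fin 3) (1 : ℝ)) :
              EuclideanSpace ℝ (Fin 3) →L[ℝ] EuclideanSpace ℝ (Fin 3)) := by
      funext y; ext i; fin_cases i <;> simp
    rw [e]; exact ContinuousLinearMap.differentiableAt _
  exact h1.smul h2

/-- **`D ê_θ(y)[w] = −(⟪w, ê_θ⟫/r) ê_r`** off the axis. [folklore] -/
theorem fderiv_eTheta_apply {y : EuclideanSpace ℝ (Fin 3)} (hy : cylRadius y ≠ 0) (w : EuclideanSpace ℝ (Fin 3)) :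
    fderiv ℝ eTheta y w = -((⟪w, eTheta y⟫ / cylRadius y) • eR y) := by
  set Hk : EuclideanSpace ℝ (Fin 3) →L[ℝ] EuclideanSpace ℝ (Fin 3) :=
    (-(EuclideanSpace.proj (1 : Fin 3) : EuclideanSpace ℝ (Fin 3) →L[ℝ] ℝ)).smulRight
        (EuclideanSpace.single (0 : Fin 3) (1 : ℝ)) +
      (EuclideanSpace.proj (0 : Fin 3) : EuclideanSpace ℝ (Fin 3) →L[ℝ] ℝ).smulRight
        (EuclideanSpace.single (1 : Fin 3) (1 : ℝ)) with hHk
  have hHw : ∀ v : EuclideanSpace ℝ (Fin 3), Hk v = toLp 2 ![-v 1, v 0, 0] := by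
    intro v; rw [hHk]; ext i; fin_cases i <;> simp
  have hc := (hasFDerivAt_cylRadius hy).differentiableAt.hasFDerivAt
  have h1 : HasFDerivAt (fun y => (cylRadius y)⁻¹) ((-(cylRadius y ^ 2)⁻¹) • fderiv ℝ cylRadius y) y :=
    (hasDerivAt_inv hy).comp_hasFDerivAt y hc
  have h2 : HasFDerivAt (fun y : EuclideanSpace ℝ (Fin 3) => toLp 2 ![-y 1, y 0, 0]) Hk y := by
    have e : (fun y : EuclideanSpace ℝ (Fin 3) => toLp 2 ![-y 1, y 0, 0]) = Hk := by
      funext v; exact (hHw v).symm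
    rw [e]; exact Hk.hasFDerivAt
  have h : HasFDerivAt eTheta _ y := h1.smul h2
  rw [h.fderiv]
  simp only [add_apply, smul_apply,
    ContinuousLinearMap.smulRight_apply, smul_eq_mul, fderiv_cylRadius_apply hy, hHw, horizontalRot_eq_frame hy w,
    horizontalRot_self hy, smul_add, smul_smul, smul_neg]
  have e1 : -(cylRadius y ^ 2)⁻¹ * ⟪w, eR y⟫ * cylRadius y = -((cylRadius y)⁻¹ * ⟪w, eR y⟫) := by
    field_simp
  rw [e1, div_eq_inv_mul]
  module

/-! ### Kinematic identities: frame components of `DV w` through derivatives of the components -/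

/-- **`⟪DV(y) w, ê_r⟫ = D(V_r)(y)[w] − V_θ(y) ⟪w, ê_θ⟫ / r`** off the axis (`V` differentiable at `y`): the radial component
does not commute with differentiation because the frame rotates (`D ê_r[w] = (⟪w, ê_θ⟫/r) ê_θ`).  With `w = W = γy + V` this is
the memo's `⟪(DV)W, ê_r⟫ = W·∇V_r − V_θ W_θ / t`. [folklore] -/
theorem inner_fderiv_eR_eq {V : EuclideanSpace ℝ (Fin 3) → EuclideanSpace ℝ (Fin 3)} {y : EuclideanSpace ℝ (Fin 3)}
    (hy : cylRadius y ≠ 0) (hV : DifferentiableAt ℝ V y) (w : EuclideanSpace ℝ (Fin 3)) :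
    ⟪fderiv ℝ V y w, eR y⟫ =
      fderiv ℝ (radialVelocity V) y w - swirlVelocity V y * ⟪w, eTheta y⟫ / cylRadius y := by
  have h := (hV.hasFDerivAt.inner ℝ (differentiableAt_eR hy).hasFDerivAt)
  have e : radialVelocity V = fun y => ⟪V y, eR y⟫ := by funext y; rfl
  rw [e, h.fderiv]
  simp only [ContinuousLinearMap.comp_apply, fderivInnerCLM_apply, ContinuousLinearMap.prod_apply,
    fderiv_eR_apply hy, inner_smul_right, swirlVelocity]
  field_simp
  ring

/-- **`⟪DV(y) w, ê_θ⟫ = D(V_θ)(y)[w] + V_r(y) ⟪w, ê_θ⟫ / r`** off the axis (`D ê_θ[w] = −(⟪w, ê_θ⟫/r) ê_r`). [folklore] -/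
theorem inner_fderiv_eTheta_eq {V : EuclideanSpace ℝ (Fin 3) → EuclideanSpace ℝ (Fin 3)} {y : EuclideanSpace ℝ (Fin 3)}
    (hy : cylRadius y ≠ 0) (hV : DifferentiableAt ℝ V y) (w : EuclideanSpace ℝ (Fin 3)) :
    ⟪fderiv ℝ V y w, eTheta y⟫ =
      fderiv ℝ (swirlVelocity V) y w + radialVelocity V y * ⟪w, eTheta y⟫ / cylRadius y := by
  have h := (hV.hasFDerivAt.inner ℝ (differentiableAt_eTheta hy).hasFDerivAt)
  have e : swirlVelocity V = fun y => ⟪V y, eTheta y⟫ := by funext y; rfl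
  rw [e, h.fderiv]
  simp only [ContinuousLinearMap.comp_apply, fderivInnerCLM_apply, ContinuousLinearMap.prod_apply,
    fderiv_eTheta_apply hy, inner_neg_right, inner_smul_right, radialVelocity]
  field_simp
  ring

/-! ### The ê_r-component of the profile equation -/

/-- **AX-1: THE RADIAL COMPONENT OF THE PROFILE EQUATION.**  For a self-similar Euler profile pair
`IsSelfSimilarEulerProfile γ 0 V P` (`(1−γ)V + DV[γy + V] + ∇P = 0`) and `y` off the `x₂`-axis, with `W = γy + V(y)`:
`(1−γ) V_r(y) + D(V_r)(y)[W] − V_θ(y)²/r + ⟪∇P(y), ê_r(y)⟫ = 0` (`⟪W, ê_θ⟫ = V_θ` because `⟪y, ê_θ(y)⟫ = 0`; the centrifugal term is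
the frame rotation).  Pointwise input of the axis law (AX), HOOP-NOTE §2. [folklore] -/
theorem profile_eq_radial {γ : ℝ} {V : EuclideanSpace ℝ (Fin 3) → EuclideanSpace ℝ (Fin 3)} {P : EuclideanSpace ℝ (Fin 3) → ℝ}
    (hprof : IsSelfSimilarEulerProfile γ 0 V P) {y : EuclideanSpace ℝ (Fin 3)} (hy : cylRadius y ≠ 0) :
    (1 - γ) * radialVelocity V y + fderiv ℝ (radialVelocity V) y (γ • y + V y) -
        swirlVelocity V y ^ 2 / cylRadius y + ⟪gradient P y, eR y⟫ = 0 := by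
  have hV : DifferentiableAt ℝ V y := (hprof.contDiff_velocity.differentiable (by norm_num)) y
  have h := congrArg (fun v => ⟪v, eR y⟫) (hprof.profile_eq y)
  simp only [sub_zero, inner_add_left, inner_smul_left, inner_zero_left, RCLike.conj_to_real] at h
  rw [inner_fderiv_eR_eq hy hV, inner_add_left, inner_smul_left, inner_self_eTheta] at h
  simp only [RCLike.conj_to_real, mul_zero, zero_add] at h
  rw [radialVelocity, swirlVelocity] at *
  have e : ⟪V y, eTheta y⟫ * ⟪V y, eTheta y⟫ / cylRadius y = ⟪V y, eTheta y⟫ ^ 2 / cylRadius y := by rw [sq]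
  linarith [e]

/-- The same with the transport field written as `selfSimilarTransport`-style data `W y = γ • y + V y` abstracted:
`⟪W, ê_θ⟫ = V_θ` and `⟪W, ê_r⟫ = γ r + V_r` off the axis. [folklore] -/
theorem inner_transport_frame {γ : ℝ} {V : EuclideanSpace ℝ (Fin 3) → EuclideanSpace ℝ (Fin 3)} {y : EuclideanSpace ℝ (Fin 3)}
    (hy : cylRadius y ≠ 0) :
    ⟪γ • y + V y, eTheta y⟫ = swirlVelocity V y ∧ ⟪γ • y + V y, eR y⟫ = γ * cylRadius y + radialVelocity V y := by
  have hr2 : cylRadius y ^ 2 = y 0 ^ 2 + y 1 ^ 2 := cylRadius_sq y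
  refine ⟨?_, ?_⟩
  · rw [inner_add_left, inner_smul_left, inner_self_eTheta, swirlVelocity]; simp
  · rw [inner_add_left, inner_smul_left, radialVelocity, inner_eR_eq y y]
    simp only [RCLike.conj_to_real]
    rw [show (y 0 * y 0 + y 1 * y 1) / cylRadius y = cylRadius y by
      rw [div_eq_iff hy]; nlinarith [hr2]]

end Summit.NavierStokesRegularity.NavierStokesRegularity.Theorems.PowerGaugeEulerLiouville.HoopCore

end
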